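import Mathlib.Analysis.SpecialFunctions.Log.Base
import Mathlib.Analysis.SpecialFunctions.Pow.Real
import HarnessLib

/-!
# Fluid computer — support: the dyadic optimisation with a general tail exponent (pure real analysis)

HONEST FRAMING (cell `pub-fluidc`, verbatim): *low prior, high value-of-information experiment on Tao's
machine paradigm; NOT a claim that NS blows up.* Support file of `SuperLadder` (L54); no fluid content. Generalises
`DyadicOptimisation.dyadic_optimisation` (the case `θ = 1/2`).

* `dyadic_optimisation_gen` — if `a ≤ α 2^{3J/2} + β 2^{−θJ} √d` for EVERY `J ∈ ℤ`, with `a, β, θ > 0` and `α, d ≥ 0`,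
  then `a^{2 + 4θ/3} ≤ 2^{2 + 10θ/3} β² α^{4θ/3} d`: for `α > 0` choose `J = ⌊log₂ (a/2α)^{2/3}⌋`, so that the head
  `α 2^{3J/2}` is at most `a/2` while `2^J > (a/2α)^{2/3}/2`; for `α = 0` no `d` satisfies the hypothesis.

0 sorry; no definitions.
-/

noncomputable section

open Set

namespace Summit.NavierStokesRegularity.FluidComputer.SuperLadderOptimisation

/-- **Dyadic optimisation, general tail exponent** (real bookkeeping): if `a ≤ α 2^{3J/2} + β 2^{−θJ} √d` for EVERY
`J ∈ ℤ`, with `a, β, θ > 0` and `α, d ≥ 0`, then `a^{2+4θ/3} ≤ 2^{2+10θ/3} β² α^{4θ/3} d`. [folklore] -/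
theorem dyadic_optimisation_gen {a α β d θ : ℝ} (ha : 0 < a) (hα : 0 ≤ α) (hβ : 0 < β) (hd : 0 ≤ d) (hθ : 0 < θ)
    (h : ∀ J : ℤ, a ≤ α * (2 : ℝ) ^ ((3 / 2 : ℝ) * J) + β * (2 : ℝ) ^ (-θ * J) * Real.sqrt d) :
    a ^ (2 + 4 * θ / 3) ≤ (2 : ℝ) ^ (2 + 10 * θ / 3) * β ^ 2 * α ^ (4 * θ / 3) * d := by
  rcases hα.eq_or_lt with hα0 | hαpos
  · -- `α = 0`: the hypothesis fails for large `J`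
    exfalso
    obtain ⟨n, hn⟩ := pow_unbounded_of_one_lt (β * Real.sqrt d / a) (by norm_num : (1 : ℝ) < 2)
    set J : ℤ := ⌈(n : ℝ) / θ⌉ with hJdef
    have hJ := h J
    rw [← hα0, zero_mul, zero_add] at hJ
    have hθJ : (n : ℝ) ≤ θ * J := by
      have := Int.le_ceil ((n : ℝ) / θ)
      rw [hJdef]
      rw [div_le_iff₀ hθ] at this
      linarith
    have hpow : (2 : ℝ) ^ (-θ * J) ≤ ((2 : ℝ) ^ n)⁻¹ := by
      rw [← Real.rpow_natCast, ← Real.rpow_neg (by norm_num : (0 : ℝ) ≤ 2)]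
      exact Real.rpow_le_rpow_of_exponent_le (by norm_num) (by linarith)
    have h2n : (0 : ℝ) < 2 ^ n := by positivity
    have hJ' : a * 2 ^ n ≤ β * Real.sqrt d := by
      have h1 : a ≤ β * ((2 : ℝ) ^ n)⁻¹ * Real.sqrt d :=
        hJ.trans (mul_le_mul_of_nonneg_right (mul_le_mul_of_nonneg_left hpow hβ.le) (Real.sqrt_nonneg _))
      rw [show β * ((2 : ℝ) ^ n)⁻¹ * Real.sqrt d = β * Real.sqrt d / 2 ^ n by ring] at h1
      rwa [le_div_iff₀ h2n] at h1
    rw [div_lt_iff₀ ha, show (2 : ℝ) ^ n * a = a * 2 ^ n by ring] at hn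
    exact absurd (hJ'.trans_lt hn) (lt_irrefl _)
  · -- `α > 0`: choose the level
    set x : ℝ := (a / (2 * α)) ^ (2 / 3 : ℝ) with hx
    have hx0 : 0 < x := by positivity
    set J : ℤ := ⌊Real.logb 2 x⌋ with hJdef
    have h2J : (2 : ℝ) ^ (J : ℝ) ≤ x := by
      calc (2 : ℝ) ^ (J : ℝ) ≤ (2 : ℝ) ^ Real.logb 2 x :=
            Real.rpow_le_rpow_of_exponent_le (by norm_num) (Int.floor_le _)
        _ = x := Real.rpow_logb two_pos (by norm_num) hx0
    have hxJ : x < (2 : ℝ) ^ ((J : ℝ) + 1) := by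
      calc x = (2 : ℝ) ^ Real.logb 2 x := (Real.rpow_logb two_pos (by norm_num) hx0).symm
        _ < (2 : ℝ) ^ ((J : ℝ) + 1) :=
            Real.rpow_lt_rpow_of_exponent_lt (by norm_num) (Int.lt_floor_add_one _)
    -- head ≤ a/2
    have hhead : α * (2 : ℝ) ^ ((3 / 2 : ℝ) * J) ≤ a / 2 := by
      have h1 : (2 : ℝ) ^ ((3 / 2 : ℝ) * J) = ((2 : ℝ) ^ (J : ℝ)) ^ (3 / 2 : ℝ) := by
        rw [← Real.rpow_mul (by norm_num)]
        congr 1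
        ring
      have h2 : ((2 : ℝ) ^ (J : ℝ)) ^ (3 / 2 : ℝ) ≤ x ^ (3 / 2 : ℝ) :=
        Real.rpow_le_rpow (by positivity) h2J (by norm_num)
      have h3 : x ^ (3 / 2 : ℝ) = a / (2 * α) := by
        rw [hx, ← Real.rpow_mul (by positivity)]
        norm_num
      rw [h1]
      calc α * ((2 : ℝ) ^ (J : ℝ)) ^ (3 / 2 : ℝ) ≤ α * (a / (2 * α)) := by
            rw [← h3]; exact mul_le_mul_of_nonneg_left h2 hα
        _ = a / 2 := by field_simp
    -- hence the tail is ≥ a/2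
    have htail : a / 2 ≤ β * (2 : ℝ) ^ (-θ * J) * Real.sqrt d := by linarith [h J]
    -- square: `(a/2)² ≤ β² 2^{−2θJ} d`
    have hsq : (a / 2) ^ 2 ≤ β ^ 2 * (2 : ℝ) ^ (-(2 * θ) * J) * d := by
      have e : (β * (2 : ℝ) ^ (-θ * J) * Real.sqrt d) ^ 2 = β ^ 2 * (2 : ℝ) ^ (-(2 * θ) * J) * d := by
        rw [mul_pow, mul_pow, Real.sq_sqrt hd, ← Real.rpow_natCast ((2 : ℝ) ^ (-θ * J)),
          ← Real.rpow_mul (by norm_num)]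
        congr 2
        push_cast
        ring
      rw [← e]
      exact pow_le_pow_left₀ (by positivity) htail 2
    -- `2^{J} > x/2`, hence `2^{2θJ} ≥ (x/2)^{2θ}`
    have h2Jx : x / 2 < (2 : ℝ) ^ (J : ℝ) := by
      rw [Real.rpow_add_one (by norm_num)] at hxJ
      linarith
    have h2Jpos : 0 < (2 : ℝ) ^ (J : ℝ) := by positivity
    have hθ2 : 0 ≤ 2 * θ := by linarith
    have hpow2θ : (x / 2) ^ (2 * θ) ≤ (2 : ℝ) ^ ((2 * θ) * J) := by
      have e : (2 : ℝ) ^ ((2 * θ) * J) = ((2 : ℝ) ^ (J : ℝ)) ^ (2 * θ) := by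
        rw [← Real.rpow_mul (by norm_num)]
        congr 1
        ring
      rw [e]
      exact Real.rpow_le_rpow (div_pos hx0 two_pos).le h2Jx.le hθ2
    have hneg : (2 : ℝ) ^ (-(2 * θ) * J) = ((2 : ℝ) ^ ((2 * θ) * J))⁻¹ := by
      rw [show -(2 * θ) * (J : ℝ) = -((2 * θ) * J) by ring, Real.rpow_neg (by norm_num)]
    have h22pos : 0 < (2 : ℝ) ^ ((2 * θ) * J) := by positivity
    -- combine: `(a/2)² (x/2)^{2θ} ≤ β² d`
    have hmain : (a / 2) ^ 2 * (x / 2) ^ (2 * θ) ≤ β ^ 2 * d := by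
      have h1 : (a / 2) ^ 2 * (2 : ℝ) ^ ((2 * θ) * J) ≤ β ^ 2 * d := by
        rw [hneg] at hsq
        calc (a / 2) ^ 2 * (2 : ℝ) ^ ((2 * θ) * J) ≤ β ^ 2 * ((2 : ℝ) ^ ((2 * θ) * J))⁻¹ * d * (2 : ℝ) ^ ((2 * θ) * J) :=
              mul_le_mul_of_nonneg_right hsq h22pos.le
          _ = β ^ 2 * d := by field_simp
      exact le_trans (mul_le_mul_of_nonneg_left hpow2θ (by positivity)) h1
    -- `(x/2)^{2θ} = x^{2θ}/2^{2θ}`, `x^{2θ} = a^{4θ/3}/(2α)^{4θ/3}`, `(2α)^{4θ/3} = 2^{4θ/3} α^{4θ/3}`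
    have hx2θ : (x / 2) ^ (2 * θ) = a ^ (4 * θ / 3) / ((2 : ℝ) ^ (4 * θ / 3) * α ^ (4 * θ / 3) * (2 : ℝ) ^ (2 * θ)) := by
      rw [Real.div_rpow hx0.le (by norm_num), hx, ← Real.rpow_mul (by positivity),
        Real.div_rpow ha.le (by positivity), Real.mul_rpow (by norm_num) hα,
        show (2 / 3 : ℝ) * (2 * θ) = 4 * θ / 3 by ring]
      field_simp
    have ha2 : a ^ (2 + 4 * θ / 3) = a ^ 2 * a ^ (4 * θ / 3) := by
      rw [Real.rpow_add ha, Real.rpow_two]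
    have h2exp : (2 : ℝ) ^ (2 + 10 * θ / 3) = 4 * ((2 : ℝ) ^ (4 * θ / 3) * (2 : ℝ) ^ (2 * θ)) := by
      rw [← Real.rpow_add two_pos, show (2 : ℝ) + 10 * θ / 3 = 2 + (4 * θ / 3 + 2 * θ) by ring,
        Real.rpow_add two_pos, Real.rpow_two]
      norm_num
    rw [hx2θ] at hmain
    have hpos1 : 0 < (2 : ℝ) ^ (4 * θ / 3) * α ^ (4 * θ / 3) * (2 : ℝ) ^ (2 * θ) := by positivity
    rw [show (a / 2) ^ 2 * (a ^ (4 * θ / 3) / ((2 : ℝ) ^ (4 * θ / 3) * α ^ (4 * θ / 3) * (2 : ℝ) ^ (2 * θ))) =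
        a ^ 2 * a ^ (4 * θ / 3) / (4 * ((2 : ℝ) ^ (4 * θ / 3) * α ^ (4 * θ / 3) * (2 : ℝ) ^ (2 * θ))) by
          field_simp; ring,
      div_le_iff₀ (by positivity)] at hmain
    rw [ha2, h2exp]
    calc a ^ 2 * a ^ (4 * θ / 3) ≤ β ^ 2 * d * (4 * ((2 : ℝ) ^ (4 * θ / 3) * α ^ (4 * θ / 3) * (2 : ℝ) ^ (2 * θ))) :=
          hmain
      _ = 4 * ((2 : ℝ) ^ (4 * θ / 3) * (2 : ℝ) ^ (2 * θ)) * β ^ 2 * α ^ (4 * θ / 3) * d := by ring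

end Summit.NavierStokesRegularity.FluidComputer.SuperLadderOptimisation

end
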